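import Summits.QuantumFields.YangMills.Theorems.UnitScaleTiltProp7CombTildRem2HMcomb2EnvelopeT3
import Summits.QuantumFields.YangMills.Theorems.UnitScaleTiltProp7CombHMcombHoldsT3
import Summits.QuantumFields.YangMills.Theorems.UnitScaleTiltProp7CombHGjHoldsT3
import HarnessLib

/-!
# Route `UnitScaleTilt`, crux K1 «MinimiserStabilityRegPr» (stmt-QuantumFields-19200), route-R (β): «`hMc₂_holds`» — G3's SECOND BINDER `hMc₂` OF
# ✓`Prop7HDOfCombRows.hD_of_hMcomb` IS A TREE THEOREM (one line over three landed files)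

«(O2) groundwork» (★★OWNER `ym3-torus-plan` g29∕g30 RULINGS №20 (2), №22 (c)).  Cell `ym3-torus`, D-0154 (3c) R3 twin-width seat `ym-routeR-w3` (gen 9).  THEOREMS ONLY
(0 `def`, 0 `sorry`); `--supports stmt-QuantumFields-19200 --as helper`, count-neutral.  YM₃ on T³ is a ladder rung (R3), not the Clay problem; nothing here claims `hPA2`, `hcoS`,
E′, the stub `stub_existenceMinimalOrbit`, the crux, d = 4 or the mass gap; the DISPLAY event (which EX face row this discharges, and when) is the EX-namer's ∕ ★★OWNER's.

THE POINT.  ★px17 g5's M-4c ✓p722676 `Prop7CombTildRem2HMcomb2EnvelopeT3.hMc₂_of_hMc_of_hGj (hMc) (hGj) : ⟨hMc₂⟩` reduces G3's linearised-comb-remainder row `hMc₂` to the comb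
level-mass envelope `hMc` and the norm-gap envelope `hGj`; ★routeR-w1 g10's F-8c-final-2 ✓p721589 `Prop7CombHMcombHolds.hMcomb_holds : ⟨hMc⟩` and this seat's F-9c-2 ✓p723432
`Prop7CombHGjHolds.hGj_holds : ⟨hGj⟩` inhabit both (types token for token) — so ★★★ `hMc₂_holds : ⟨hMc₂⟩ := hMc₂_of_hMc_of_hGj hMcomb_holds hGj_holds`.  The TYPE below is G3
✓p708782 `hD_of_hMcomb`'s `(hMc₂ : …)` binder text VERBATIM (= M-4c's conclusion; script-checked equal after whitespace normalisation).
HONEST SCOPE.  Zero mathematics (one application); everything is in the three cited files and their chains ([B8]∕[B7] comb tower, ✓F-6d∕F-7∕F-8∕F-9, H∕M-chains).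

References: T. Bałaban, CMP **102** (1985) 277–309 [Balaban1985Variational] ((2), (6) p.278, (19) p.281, Prop. 7 p.299); CMP **98** (1985) 17–51 [Balaban1985Averaging]
((65)–(69) p.29, Prop. 3 (113)–(126) pp.34–36); CMP **109** (1987) 249–301 [Balaban1987RG1] ((0.4) p.253).
-/

set_option autoImplicit false

noncomputable section

open scoped BigOperators Matrix.Norms.L2Operator

namespace Summit.QuantumFields.YangMills.Theorems.Prop7CombHMc2Holds

open Finset NormedSpace
open Literature.MathematicalPhysics.QuantumFieldTheory.Balaban1983to89
open Literature.MathematicalPhysics.QuantumFieldTheory.Balaban1983to89.T3ContinuumYM3Torus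
open Literature.MathematicalPhysics.QuantumFieldTheory.Balaban1983to89.T3UnitLawDensityEML (ℰp)
open Literature.MathematicalPhysics.QuantumFieldTheory.Balaban1983to89.T3ConstrainedMinimiser (fibre)
open Literature.MathematicalPhysics.QuantumFieldTheory.Balaban1983to89.T3PrintedRegularMinimiser
open Literature.MathematicalPhysics.QuantumFieldTheory.Balaban1983to89.T3RegularMinimiser
open Literature.MathematicalPhysics.QuantumFieldTheory.Balaban1983to89.T3Thm1Carrier
open T4Continuum T4ReflectionCone BlockAveraging AveragingRT ExpMeanLog BlockAveragingEMLLinearised BlockAveragingEMLLinearisedBackground BlockAveragingEMLProp2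
open T3SectALandauChart (emb15 eta eta_pos bgUnits In19)
open B7Prop1Explicit renaming Site → LSite
open B7Prop1Explicit (seg boxVec gammaWord Wcx Xavg expUnit)
open B7Prop2Explicit (avgIter)
open B7Eq92Concrete (tildIter)
open B7Prop3GeneralRotated (tsum)
open B9Eq39Adjoint (divB)
open B9TorusCalculus (torusT)
open B10Eq27TorusAxialLog (pull transl unitsField toUField)
open Summit.QuantumFields.YangMills.Theorems.Prop7SPrint (basePt RestrictedPrint AvgCondPrint IsLandauPrint)
open Summit.QuantumFields.YangMills.Theorems.Prop7TPrint (expHermField)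

open Summit.QuantumFields.YangMills.Theorems.Prop7CombTildRem2HMcomb2EnvelopeT3 (hMc₂_of_hMc_of_hGj)
open Summit.QuantumFields.YangMills.Theorems.Prop7CombHMcombHolds (hMcomb_holds)
open Summit.QuantumFields.YangMills.Theorems.Prop7CombHGjHolds (hGj_holds)

/-- ★★★ **`hMc₂_holds` — G3 ✓`Prop7HDOfCombRows.hD_of_hMcomb`'s SECOND BINDER `hMc₂`, TYPE VERBATIM**: for every `L > 1`, `B₁′ > 0` there are `e₂ > 0`, `A₂ B₂ B₂′ ≥ 0` with, for
every member (`W ∈ regFibrePr F n K e V`, `0 < e ≤ e₂`, criticality, `In19 (2B₁′e)`, `AvgCondPrint`, `IsLandauPrint`) and every level `l < K − n`,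
`Σ_{z,κ} ‖Ũˡ(z,κ) − 1 − D(Ũˡ(z,κ))(0)[iX]‖ ≤ A₂·Σ‖X‖²·(Lˡ)⁻¹ + (B₂·(K_W(iX) + DIV_W(iX)) + B₂′·ℓ⁻²·Σ‖X‖²)·Lˡ` — ✓M-4c `hMc₂_of_hMc_of_hGj` at ✓`hMcomb_holds`, ✓`hGj_holds`.
[cite: Balaban1985Variational, (2), (6) p.278, Prop. 7 p.299; Balaban1985Averaging, Prop. 3 (113)–(126) pp.34–36; Balaban1987RG1, (0.4) p.253] -/
theorem hMc₂_holds :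
 ∀ (L : ℕ), 1 < L → ∀ (B₁' : ℝ), 0 < B₁' → ∃ e₂ A₂ B₂ B₂' : ℝ, 0 < e₂ ∧ 0 ≤ A₂ ∧ 0 ≤ B₂ ∧ 0 ≤ B₂' ∧
      ∀ (F : T3Family), F.L = L → ∀ (n K : ℕ) (hnK : n < K) (e : ℝ) (V : GaugeField (F.P n) 0 (Matrix.specialUnitaryGroup (Fin 2) ℂ))
        (W : GaugeField (F.P K) 0 (Matrix.specialUnitaryGroup (Fin 2) ℂ)) (X : PBond (F.P K) 0 → Matrix (Fin 2) (Fin 2) ℂ),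
        0 < e → e ≤ e₂ → W ∈ regFibrePr F n K hnK.le e V →
        (∀ γ : ℝ → GaugeField (F.P K) 0 (Matrix.specialUnitaryGroup (Fin 2) ℂ), γ 0 = W → (∀ t, γ t ∈ fibre F ℰp n K hnK.le V) →
          (∀ b, DifferentiableAt ℝ (fun t => ((γ t b : Matrix.specialUnitaryGroup (Fin 2) ℂ) : Matrix (Fin 2) (Fin 2) ℂ)) 0) →
            deriv (fun t => wilsonAction4 (γ t)) 0 = 0) →
        In19 F n K (2 * B₁' * e) W (expHermField X) X → AvgCondPrint F n K hnK.le V W X → IsLandauPrint F n K W X →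
          ∀ l : ℕ, l < K - n →
            ∑ z : Site (F.P K) l, ∑ κ : Fin (F.P K).d,
              ‖((tildIter (F.P K).L (pull (bgUnits F K W) (basePt F n K)) (pull (fun b => expUnit (Complex.I • X b)) (basePt F n K)) l
              (fun μ => ((z μ).val : ℤ)) κ : (Matrix (Fin 2) (Fin 2) ℂ)ˣ) : Matrix (Fin 2) (Fin 2) ℂ) - 1
            - (fderiv ℂ (fun A' : PBond (F.P K) 0 → Matrix (Fin 2) (Fin 2) ℂ =>
                ((tildIter (F.P K).L (pull (bgUnits F K W) (basePt F n K)) (pull (fun b => expUnit (A' b)) (basePt F n K)) l (fun μ => ((z μ).val : ℤ)) κ :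
                  (Matrix (Fin 2) (Fin 2) ℂ)ˣ) : Matrix (Fin 2) (Fin 2) ℂ)) 0) (fun b => Complex.I • X b)‖
              ≤ A₂ * (∑ b : PBond (F.P K) 0, ‖X b‖ ^ 2) * ((F.L : ℝ) ^ l)⁻¹
                + (B₂ * ((∑ p : Plaq (F.P K) 0, ‖((Complex.I • X ⟨p.src, p.μ⟩) + ((W ⟨p.src, p.μ⟩ : Matrix (Fin 2) (Fin 2) ℂ) * (Complex.I • X ⟨p.src.shift p.μ, p.ν⟩) * star (W ⟨p.src, p.μ⟩ : Matrix (Fin 2) (Fin 2) ℂ))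
            - (((W ⟨p.src, p.μ⟩ * W ⟨p.src.shift p.μ, p.ν⟩ * (W ⟨p.src.shift p.ν, p.μ⟩)⁻¹ : Matrix.specialUnitaryGroup (Fin 2) ℂ) : Matrix (Fin 2) (Fin 2) ℂ) * (Complex.I • X ⟨p.src.shift p.ν, p.μ⟩) * star ((W ⟨p.src, p.μ⟩ * W ⟨p.src.shift p.μ, p.ν⟩ * (W ⟨p.src.shift p.ν, p.μ⟩)⁻¹ : Matrix.specialUnitaryGroup (Fin 2) ℂ) : Matrix (Fin 2) (Fin 2) ℂ))
            - (((GaugeField.plaqHol W p : Matrix.specialUnitaryGroup (Fin 2) ℂ) : Matrix (Fin 2) (Fin 2) ℂ) * (Complex.I • X ⟨p.src, p.ν⟩) * star ((GaugeField.plaqHol W p : Matrix.specialUnitaryGroup (Fin 2) ℂ) : Matrix (Fin 2) (Fin 2) ℂ)))‖ ^ 2) + (∑ x : Site (F.P K) 0, ∑ j : Fin 2, ∑ k : Fin 2,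
              ‖(divB (torusT (F.P K) 0) (fun κ z => unitsField (toUField W) ⟨z, κ⟩) (fun κ z => Complex.I • X ⟨z, κ⟩) x) j k‖ ^ 2))
                  + B₂' * (((F.L : ℝ) ^ (K - n)) ^ 2)⁻¹ * (∑ b : PBond (F.P K) 0, ‖X b‖ ^ 2)) * (F.L : ℝ) ^ l :=
  hMc₂_of_hMc_of_hGj hMcomb_holds hGj_holds

-- KERNEL WITNESS (no new content): G3 consumes the two landed knits' rows by name.
example := fun hN2s => Summit.QuantumFields.YangMills.Theorems.Prop7HDOfCombRows.hD_of_hMcomb hMcomb_holds hMc₂_holds hN2s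

end Summit.QuantumFields.YangMills.Theorems.Prop7CombHMc2Holds

end
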